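import Literature.NumberTheory.EllipticCurves.CasselsTateLemma615
import Literature.NumberTheory.GaloisRepresentations.ArchimedeanLocalDuality
import HarnessLib

/-!
# Local Tate duality for `E[n]` at the infinite places (the archimedean `hdual` of Milne I Lemma 6.15)

Topic `NumberTheory/EllipticCurves`; namespace `Literature.NumberTheory.EllipticCurves` (as the siblings
`LocalWeilPairingDuality.lean`, `ArchimedeanKummerImageMaximal.lean`, `CasselsTateLemma615.lean`).  Theorems
only: **no named fact and no definition is introduced** (D-0026).

Milne, *ADT*, I Thm. 2.13(a) (archimedean local Tate duality; tree `ArchimedeanLocalDuality.lean`, proved for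
`r = 1` and finite modules) specialised to the self-dual module `E[n]` of an elliptic curve `E = W` over a
number field `K` and an infinite place `w` (`K_w ≅ ℝ` or `ℂ`):

* `eq_zero_of_forall_weilCupProduct_eq_zero_infinitePlace` (+ `_right`): the cup product
  `H¹(K_w, E[n]) × H¹(K_w, E[n]) → H²(K_w, μₙ)` of a non-degenerate alternating equivariant `μₙ`-valued
  pairing `e` on `E[n]` (a Weil pairing) has trivial kernels; `bijective_weilCupProduct_infinitePlace`: composed
  with any additive `ι : H²(K_w, μₙ) → ℤ/n` injective on `H²(K_w, μₙ)` it is a perfect pairing;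
* the same for the DESCENDED pairing `E[m] × E[m] → μ_{m²}`, `(S, T) ↦ e_{m²}(ι S, T̃)` of
  `WeilPairingLevelDescent.lean` (`eq_zero_of_forall_descCupProduct_eq_zero_infinitePlace`), whence the
  hypothesis `hdual` of Milne I Lemma 6.15 (tree `forall_mem_selmerGroup_sumPairing_eq_zero_iff`,
  `CasselsTateLemma615.lean`) at an infinite place `v = Sum.inl w` for every family `inv` of local invariant
  maps injective at `w` (`descLocalPairing_inl_eq_zero_of_forall`);
* the `hdual`-free form of the maximal isotropy of the local Kummer condition at the infinite places
  (`forall_mem_kummerLocalConditionAt_weilCupProduct_eq_zero_iff_infinitePlace_of_injective`, `…_inl_…`):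
  `(∀ y ∈ 𝓛_w, x ∪ₑ y = 0) ↔ x ∈ 𝓛_w` — the archimedean local input of Milne I Lemma 6.15 (Milne I Rem. 3.7),
  now depending only on the injectivity of `ι` on `H²(K_w, μₙ)`.

What remains an input at the real places is thus only the injectivity of the chosen `inv_w` on
`H²(K_w, μ_N)` (for the invariant map of class field theory, `H²(ℝ, μ_N) = Br(ℝ)[N] ≅ ½ℤ/ℤ ↪ ℤ/N` for even
`N`, and `0` for odd `N`) — a property of the Poitou–Tate family, not of the curve.

Also recorded: the small algebra of the Weil pairing homs (`weilPairingHom_swap_eq_neg`: an alternating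
bi-additive pairing is antisymmetric; `weilPairingHom_injective`, `weilPairingHom_flip_injective`,
`descendHom_injective`, `descendHom_flip_injective`).

Motivation: provefact `WeierstrassCurve.exists_casselsTate_pairing` (Silverman *AEC* X.4.14; Milne *ADT*
I Thm. 6.13(a) through Lemma 6.15 with `S ⊇` the archimedean places).

## References

* [MilneADT2006] J. S. Milne, *Arithmetic Duality Theorems*, 2nd ed. (2006), Ch. I, Thm. 2.13(a), Rem. 3.7,
  Lemma 6.15.
* [SilvermanAEC2009] J. H. Silverman, *The Arithmetic of Elliptic Curves*, 2nd ed., Prop. III.8.1 (the Weil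
  pairing is bilinear, alternating, non-degenerate, Galois invariant, compatible).
-/

noncomputable section

open scoped Classical

universe u

namespace Literature.NumberTheory.EllipticCurves

open CategoryTheory _root_.WeierstrassCurve Field Function NumberField
open Literature.NumberTheory.GaloisRepresentations Literature.NumberTheory.GaloisCohomology
open Literature.NumberTheory.GaloisRepresentations.DiscreteGaloisModule (mu MuCarrier pairing)
open scoped ContRepresentation

-- Cup products need `LocallyCompactSpace Γ`; as in the tree's cup-product files, the compactness of
-- absolute Galois groups is a local instance only.
attribute [local instance] absoluteGaloisGroup_compactSpace

/-! ## Antisymmetry and perfectness of an alternating non-degenerate pairing on `E[n]` -/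

section WeilHom

variable {F : Type u} [Field F] (W : WeierstrassCurve F) (n : ℕ) [NeZero n]
variable (e : geomTorsion W n → geomTorsion W n → AlgebraicClosure F)
  (hμ : ∀ S T, e S T ^ n = 1)
  (hadd₁ : ∀ S₁ S₂ T, e (S₁ + S₂) T = e S₁ T * e S₂ T)
  (hadd₂ : ∀ S T₁ T₂, e S (T₁ + T₂) = e S T₁ * e S T₂)

/-- **An alternating bi-additive pairing is antisymmetric**: `e(T, S) = e(S, T)⁻¹`, additively
`w T S = -w S T` (expand `w(S + T, S + T) = 0`).  Silverman, *AEC*, III.8.1(b).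
[cite: SilvermanAEC2009, Prop. III.8.1(b)] -/
theorem weilPairingHom_swap_eq_neg (halt : ∀ T, e T T = 1) (S T : geomTorsion W n) :
    weilPairingHom W n e hμ hadd₁ hadd₂ T S = -weilPairingHom W n e hμ hadd₁ hadd₂ S T := by
  have h : weilPairingHom W n e hμ hadd₁ hadd₂ T S + weilPairingHom W n e hμ hadd₁ hadd₂ S T = 0 := by
    have h := weilPairingHom_self W n e hμ hadd₁ hadd₂ halt (S + T)
    simp only [map_add, AddMonoidHom.add_apply, weilPairingHom_self W n e hμ hadd₁ hadd₂ halt, zero_add,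
      add_zero] at h
    exact h
  exact eq_neg_of_add_eq_zero_left h

/-- Non-degeneracy in the second variable: `T ↦ w(·, T)` is injective. [cite: SilvermanAEC2009, Prop. III.8.1(c)] -/
theorem weilPairingHom_flip_injective (hnondeg : ∀ T, (∀ S, e S T = 1) → T = 0) :
    Injective (weilPairingHom W n e hμ hadd₁ hadd₂).flip := by
  refine (injective_iff_map_eq_zero _).mpr fun T hT => hnondeg T fun S => ?_
  have h := DFunLike.congr_fun hT S
  rw [AddMonoidHom.flip_apply, AddMonoidHom.zero_apply, muCarrier_eq_iff, coe_weilPairingHom] at h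
  exact h

/-- Non-degeneracy in the first variable (from alternation and non-degeneracy in the second):
`S ↦ w(S, ·)` is injective. [cite: SilvermanAEC2009, Prop. III.8.1(b),(c)] -/
theorem weilPairingHom_injective (halt : ∀ T, e T T = 1) (hnondeg : ∀ T, (∀ S, e S T = 1) → T = 0) :
    Injective (weilPairingHom W n e hμ hadd₁ hadd₂) := by
  refine (injective_iff_map_eq_zero _).mpr fun S hS => ?_
  refine (injective_iff_map_eq_zero _).mp (weilPairingHom_flip_injective W n e hμ hadd₁ hadd₂ hnondeg) S ?_
  refine AddMonoidHom.ext fun T => ?_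
  rw [AddMonoidHom.flip_apply, weilPairingHom_swap_eq_neg W n e hμ hadd₁ hadd₂ halt S T, hS,
    AddMonoidHom.zero_apply, neg_zero]

end WeilHom

section DescHom

variable {F : Type u} [Field F] [CharZero F] (W : WeierstrassCurve F) (k d : ℕ) [NeZero k] [NeZero d]
variable (e : geomTorsion W ((k * d : ℕ) : ℤ) → geomTorsion W ((k * d : ℕ) : ℤ) → AlgebraicClosure F)
  (hμ : ∀ S T, e S T ^ (k * d) = 1)
  (hadd₁ : ∀ S₁ S₂ T, e (S₁ + S₂) T = e S₁ T * e S₂ T)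
  (hadd₂ : ∀ S T₁ T₂, e S (T₁ + T₂) = e S T₁ * e S T₂)

/-- The descended pairing `E[d] × E[d] → μ_{kd}` is non-degenerate in the second variable (tree
`eq_zero_of_forall_descendHom_eq_zero`, as injectivity of the flipped hom). [folklore] -/
theorem descendHom_flip_injective (hnd : ∀ T, (∀ S, e S T = 1) → T = 0) :
    Injective (descendHom W k d e hμ hadd₁ hadd₂).flip := by
  refine (injective_iff_map_eq_zero _).mpr fun T hT =>
    eq_zero_of_forall_descendHom_eq_zero W k d e hμ hadd₁ hadd₂ hnd T fun S => ?_
  exact DFunLike.congr_fun hT S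

/-- The descended pairing `E[d] × E[d] → μ_{kd}` is non-degenerate in the first variable (for `e`
alternating and non-degenerate): `descendHom S T = w(ι S, T̃)` for every `k`-th root `T̃`, every point of
`E[kd]` is such a root, `w` is non-degenerate in the first variable and `ι` is injective. [folklore] -/
theorem descendHom_injective (halt : ∀ T, e T T = 1) (hnd : ∀ T, (∀ S, e S T = 1) → T = 0) :
    Injective (descendHom W k d e hμ hadd₁ hadd₂) := by
  haveI : NeZero (k * d) := ⟨mul_ne_zero (NeZero.ne k) (NeZero.ne d)⟩
  refine (injective_iff_map_eq_zero _).mpr fun S hS => ?_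
  have h1 : weilPairingHom W (k * d) e hμ hadd₁ hadd₂ (inclKD W k d S) = 0 := by
    refine AddMonoidHom.ext fun T' => ?_
    rw [← descendHom_apply_eq W k d e hμ hadd₁ hadd₂ S (mulK W k d T') T' rfl, hS, AddMonoidHom.zero_apply,
      AddMonoidHom.zero_apply]
  have h2 : inclKD W k d S = 0 :=
    (injective_iff_map_eq_zero _).mp (weilPairingHom_injective W (k * d) e hμ hadd₁ hadd₂ halt hnd) _ h1
  exact Subtype.ext (congrArg Subtype.val h2 :)

end DescHom

/-! ## The Weil pairing on `H¹(K_w, E[n])` at an infinite place -/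

section InfinitePlace

variable {K : Type u} [Field K] [NumberField K] (W : WeierstrassCurve K) (n : ℕ) [NeZero n] [W.IsElliptic]
variable (e : geomTorsion W n → geomTorsion W n → AlgebraicClosure K)
  (hμ : ∀ S T, e S T ^ n = 1)
  (hadd₁ : ∀ S₁ S₂ T, e (S₁ + S₂) T = e S₁ T * e S₂ T)
  (hadd₂ : ∀ S T₁ T₂, e S (T₁ + T₂) = e S T₁ * e S T₂)
  (w : InfinitePlace K)

attribute [local instance] finite_geomTorsion_of_neZero

/-- **Local Tate duality for `E[n]` at an infinite place, left kernel** (Milne, *ADT*, I Thm. 2.13(a) for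
`M = E[n]`, `M^D ≅ E[n]` by the Weil pairing): for a non-degenerate alternating equivariant `e`, if
`x ∪ₑ y = 0` in `H²(K_w, μₙ)` for all `y ∈ H¹(K_w, E[n])` then `x = 0`. [cite: MilneADT2006, Ch. I, Thm. 2.13] -/
theorem eq_zero_of_forall_weilCupProduct_eq_zero_infinitePlace
    (hgal : ∀ (σ : absoluteGaloisGroup K) (S T : geomTorsion W n), σ • e S T = e (σ • S) (σ • T))
    (halt : ∀ T, e T T = 1) (hnondeg : ∀ T, (∀ S, e S T = 1) → T = 0)
    (x : galoisCohomology (GaloisRep.restrictField w.Completion (W.torsionGaloisModule n)) 1)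
    (hx : ∀ y, ((weilContPairing W n e hμ hadd₁ hadd₂ hgal).restrict
      (absGaloisRestrict K w.Completion)).cupProduct x y = 0) :
    x = 0 :=
  eq_zero_of_forall_cupProduct_pairing_eq_zero_infinitePlace (W.torsionGaloisModule n) (W.torsionGaloisModule n)
    (fun T : geomTorsion W n => AddSubgroup.torsionBy.nsmul T) (fun T : geomTorsion W n => AddSubgroup.torsionBy.nsmul T)
    (weilPairingHom W n e hμ hadd₁ hadd₂) _ (weilPairingHom_injective W n e hμ hadd₁ hadd₂ halt hnondeg)
    (weilPairingHom_flip_injective W n e hμ hadd₁ hadd₂ hnondeg) w x hx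

/-- **Local Tate duality for `E[n]` at an infinite place, right kernel.** [cite: MilneADT2006, Ch. I, Thm. 2.13] -/
theorem eq_zero_of_forall_weilCupProduct_eq_zero_right_infinitePlace
    (hgal : ∀ (σ : absoluteGaloisGroup K) (S T : geomTorsion W n), σ • e S T = e (σ • S) (σ • T))
    (halt : ∀ T, e T T = 1) (hnondeg : ∀ T, (∀ S, e S T = 1) → T = 0)
    (y : galoisCohomology (GaloisRep.restrictField w.Completion (W.torsionGaloisModule n)) 1)
    (hy : ∀ x, ((weilContPairing W n e hμ hadd₁ hadd₂ hgal).restrict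
      (absGaloisRestrict K w.Completion)).cupProduct x y = 0) :
    y = 0 :=
  eq_zero_of_forall_cupProduct_pairing_eq_zero_right_infinitePlace (W.torsionGaloisModule n)
    (W.torsionGaloisModule n) (fun T : geomTorsion W n => AddSubgroup.torsionBy.nsmul T)
    (fun T : geomTorsion W n => AddSubgroup.torsionBy.nsmul T) (weilPairingHom W n e hμ hadd₁ hadd₂) _
    (weilPairingHom_injective W n e hμ hadd₁ hadd₂ halt hnondeg)
    (weilPairingHom_flip_injective W n e hμ hadd₁ hadd₂ hnondeg) w y hy

/-- **Local Tate duality for `E[n]` at an infinite place as a perfect pairing**: for every additive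
`ι : H²(K_w, μₙ) → ℤ/n` injective on `H²(K_w, μₙ)`, both adjoints of `(x, y) ↦ ι(x ∪ₑ y)` on the finite
group `H¹(K_w, E[n])` are bijective. [cite: MilneADT2006, Ch. I, Thm. 2.13] -/
theorem bijective_weilCupProduct_infinitePlace
    (hgal : ∀ (σ : absoluteGaloisGroup K) (S T : geomTorsion W n), σ • e S T = e (σ • S) (σ • T))
    (halt : ∀ T, e T T = 1) (hnondeg : ∀ T, (∀ S, e S T = 1) → T = 0)
    (ι : galoisCohomology (GaloisRep.restrictField w.Completion (mu K n)) 2 →+ ZMod n) (hι : Injective ι)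
    (p : galoisCohomology (GaloisRep.restrictField w.Completion (W.torsionGaloisModule n)) 1 →+
      galoisCohomology (GaloisRep.restrictField w.Completion (W.torsionGaloisModule n)) 1 →+ ZMod n)
    (hp : ∀ x y, p x y = ι (((weilContPairing W n e hμ hadd₁ hadd₂ hgal).restrict
      (absGaloisRestrict K w.Completion)).cupProduct x y)) :
    Bijective p ∧ Bijective p.flip :=
  bijective_cupProduct_pairing_infinitePlace (W.torsionGaloisModule n) (W.torsionGaloisModule n)
    (fun T : geomTorsion W n => AddSubgroup.torsionBy.nsmul T) (fun T : geomTorsion W n => AddSubgroup.torsionBy.nsmul T)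
    (weilPairingHom W n e hμ hadd₁ hadd₂) _ (weilPairingHom_injective W n e hμ hadd₁ hadd₂ halt hnondeg)
    (weilPairingHom_flip_injective W n e hμ hadd₁ hadd₂ hnondeg) w ι hι p hp

/-- **Maximal isotropy of `𝓛_w` at an infinite place, `hdual`-free**: for a non-degenerate alternating
equivariant `e` on `E[n]` and any additive `ι : H²(K_w, μₙ) → ℤ/n` injective on `H²(K_w, μₙ)`,
`(∀ y ∈ 𝓛_w, x ∪ₑ y = 0) ↔ x ∈ 𝓛_w` for the local Kummer condition `𝓛_w = kummerLocalConditionAt W n K_w`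
(tree `forall_mem_kummerLocalConditionAt_weilCupProduct_eq_zero_iff_infinitePlace`, whose archimedean duality
hypothesis is now `eq_zero_of_forall_weilCupProduct_eq_zero_infinitePlace`).  Milne, *ADT*, I Rem. 3.7 and
Lemma 6.15. [cite: MilneADT2006, Ch. I, Rem. 3.7 and Lemma 6.15] -/
theorem forall_mem_kummerLocalConditionAt_weilCupProduct_eq_zero_iff_infinitePlace_of_injective
    (hgal : ∀ (σ : absoluteGaloisGroup K) (S T : geomTorsion W n), σ • e S T = e (σ • S) (σ • T))
    (halt : ∀ T, e T T = 1) (hnondeg : ∀ T, (∀ S, e S T = 1) → T = 0)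
    (ι : galoisCohomology (GaloisRep.restrictField w.Completion (mu K n)) 2 →+ ZMod n) (hι : Injective ι)
    (x : galoisCohomology (GaloisRep.restrictField w.Completion (W.torsionGaloisModule n)) 1) :
    (∀ y ∈ W.kummerLocalConditionAt n w.Completion, ((weilContPairing W n e hμ hadd₁ hadd₂ hgal).restrict
      (absGaloisRestrict K w.Completion)).cupProduct x y = 0) ↔
      x ∈ W.kummerLocalConditionAt n w.Completion :=
  forall_mem_kummerLocalConditionAt_weilCupProduct_eq_zero_iff_infinitePlace W n e hμ hadd₁ hadd₂ w hgal halt ι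
    (fun x hx => eq_zero_of_forall_weilCupProduct_eq_zero_infinitePlace W n e hμ hadd₁ hadd₂ w hgal halt hnondeg
      x fun y => hι ((hx y).trans (map_zero ι).symm)) x

/-- **Maximal isotropy of the local condition of the Kummer Selmer structure at `Sum.inl w`,
`hdual`-free** (`weilContPairingLocal`, `kummerSelmerStructure`; `ι` — e.g. the component `inv (Sum.inl w)`
of a family of local invariant maps — injective on `H²(K_w, μₙ)`).
[cite: MilneADT2006, Ch. I, Rem. 3.7 and Lemma 6.15] -/
theorem forall_mem_kummerSelmerStructure_weilCupProduct_eq_zero_iff_inl_of_injective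
    (hgal : ∀ (σ : absoluteGaloisGroup K) (S T : geomTorsion W n), σ • e S T = e (σ • S) (σ • T))
    (halt : ∀ T, e T T = 1) (hnondeg : ∀ T, (∀ S, e S T = 1) → T = 0)
    (ι : galoisCohomology ((mu K n).toLocal (Sum.inl w)) 2 →+ ZMod n) (hι : Injective ι)
    (x : galoisCohomology ((W.torsionGaloisModule n).toLocal (Sum.inl w)) 1) :
    (∀ y ∈ W.kummerSelmerStructure n (Sum.inl w),
        (weilContPairingLocal W n e hμ hadd₁ hadd₂ hgal (Sum.inl w)).cupProduct x y = 0) ↔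
      x ∈ W.kummerSelmerStructure n (Sum.inl w) := by
  have h := forall_mem_kummerLocalConditionAt_weilCupProduct_eq_zero_iff_infinitePlace_of_injective W n e hμ
    hadd₁ hadd₂ w hgal halt hnondeg
  exact h ι hι x

/-- The local Weil cup product at `Sum.inl w` has trivial left kernel (`weilContPairingLocal` form of
`eq_zero_of_forall_weilCupProduct_eq_zero_infinitePlace`). [cite: MilneADT2006, Ch. I, Thm. 2.13] -/
theorem eq_zero_of_forall_weilCupProduct_eq_zero_inl
    (hgal : ∀ (σ : absoluteGaloisGroup K) (S T : geomTorsion W n), σ • e S T = e (σ • S) (σ • T))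
    (halt : ∀ T, e T T = 1) (hnondeg : ∀ T, (∀ S, e S T = 1) → T = 0)
    (x : galoisCohomology ((W.torsionGaloisModule n).toLocal (Sum.inl w)) 1)
    (hx : ∀ y, (weilContPairingLocal W n e hμ hadd₁ hadd₂ hgal (Sum.inl w)).cupProduct x y = 0) : x = 0 := by
  have h := eq_zero_of_forall_weilCupProduct_eq_zero_infinitePlace W n e hμ hadd₁ hadd₂ w hgal halt hnondeg
  exact h x hx

end InfinitePlace

/-! ## The descended pairing `E[m] × E[m] → μ_{m²}` at an infinite place: `hdual` of Lemma 6.15 -/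

section Descended

variable {K : Type u} [Field K] [NumberField K] (W : WeierstrassCurve K) (m : ℕ) [NeZero m] [W.IsElliptic]
variable (e : geomTorsion W ((m * m : ℕ) : ℤ) → geomTorsion W ((m * m : ℕ) : ℤ) → AlgebraicClosure K)
  (hμ : ∀ S T, e S T ^ (m * m) = 1)
  (hadd₁ : ∀ S₁ S₂ T, e (S₁ + S₂) T = e S₁ T * e S₂ T)
  (hadd₂ : ∀ S T₁ T₂, e S (T₁ + T₂) = e S T₁ * e S T₂)
  (hgal : ∀ (σ : absoluteGaloisGroup K) (S T : geomTorsion W ((m * m : ℕ) : ℤ)),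
    σ • e S T = e (σ • S) (σ • T))

attribute [local instance] finite_geomTorsion_of_neZero

/-- **The cup product of the descended Weil pairing at an infinite place has trivial left kernel**
(Milne I Thm. 2.13(a) for `E[m]` with the pairing `E[m] × E[m] → μ_{m²}`, `(S, T) ↦ e_{m²}(ι S, T̃)`,
non-degenerate on both sides for `e` alternating and non-degenerate). [cite: MilneADT2006, Ch. I, Thm. 2.13] -/
theorem eq_zero_of_forall_descCupProduct_eq_zero_infinitePlace (halt : ∀ T, e T T = 1)
    (hnd : ∀ T, (∀ S, e S T = 1) → T = 0) (w : InfinitePlace K)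
    (x : galoisCohomology (GaloisRep.restrictField w.Completion (W.torsionGaloisModule (m : ℤ))) 1)
    (hx : ∀ y, ((descendPairing W m m e hμ hadd₁ hadd₂ hgal).restrict
      (absGaloisRestrict K w.Completion)).cupProduct x y = 0) :
    x = 0 :=
  haveI : NeZero (m * m) := ⟨mul_ne_zero (NeZero.ne m) (NeZero.ne m)⟩
  eq_zero_of_forall_cupProduct_pairing_eq_zero_infinitePlace (W.torsionGaloisModule (m : ℤ))
    (W.torsionGaloisModule (m : ℤ))
    (fun T : geomTorsion W (m : ℤ) => by rw [mul_nsmul', AddSubgroup.torsionBy.nsmul T, smul_zero])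
    (fun T : geomTorsion W (m : ℤ) => by rw [mul_nsmul', AddSubgroup.torsionBy.nsmul T, smul_zero])
    (descendHom W m m e hμ hadd₁ hadd₂) _ (descendHom_injective W m m e hμ hadd₁ hadd₂ halt hnd)
    (descendHom_flip_injective W m m e hμ hadd₁ hadd₂ hnd) w x hx

/-- **The hypothesis `hdual` of Milne I Lemma 6.15 at an infinite place** (tree
`forall_mem_selmerGroup_sumPairing_eq_zero_iff`, `CasselsTateLemma615.lean`, at `v = Sum.inl w`): for every
family `inv` of local invariant maps at level `m²` whose component at `w` is injective on `H²(K_w, μ_{m²})`,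
the local pairing `descLocalPairing … inv (Sum.inl w) = inv_w(· ∪_desc ·)` on `H¹(K_w, E[m])` has trivial left
kernel. [cite: MilneADT2006, Ch. I, Thm. 2.13 and Lemma 6.15] -/
theorem descLocalPairing_inl_eq_zero_of_forall (halt : ∀ T, e T T = 1) (hnd : ∀ T, (∀ S, e S T = 1) → T = 0)
    (inv : LocalInvariants K (m * m)) (w : InfinitePlace K) (hinv : Injective (inv (Sum.inl w)))
    (x : galoisCohomology (GaloisRep.restrictField (Place.Completion (Sum.inl w : Place K))
      (W.torsionGaloisModule (m : ℤ))) 1)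
    (hx : ∀ y, descLocalPairing W m e hμ hadd₁ hadd₂ hgal inv (Sum.inl w) x y = 0) : x = 0 := by
  have h := eq_zero_of_forall_descCupProduct_eq_zero_infinitePlace W m e hμ hadd₁ hadd₂ hgal halt hnd w
  exact h x fun y => hinv ((hx y).trans (map_zero _).symm)

end Descended

end Literature.NumberTheory.EllipticCurves

end
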